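import Summits.AtomisticToContinuum.BoseEinsteinCondensation.Theses.BECConjugateDomination
import Summits.AtomisticToContinuum.BoseEinsteinCondensation.Theses.BECSectorPoincareTwoScale
import Summits.AtomisticToContinuum.BoseEinsteinCondensation.Theses.BECInsertionCorrector
import Literature.MathematicalPhysics.QuantumManyBody.PeriodicBoseGasMomentumSector

/-!
# Sketch (crux-ideate r1, ideator 3) — crux `BECConjugateDomination.InfraredMinimumUncertainty`
(stmt-AtomisticToContinuum-11784): first lemmas of the two idea cards

* `landau-floor-two-channel`:  `FeynmanCeilingOfFloor`, `TwoSectorSandwich` (+ the architecture Props).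
* `susceptibility-product-two-channel`: `SusceptibilityProduct` (+ the same architecture Props).

Units `ħ = 2m = 1`; torus of side `L`; `k = 2πm/L`; `N = n + 1` particles; `n_m` = occupation of the
normalised plane wave `e_m = cellWave/√(L³)`; `S_m` structure factor and `ν_m` Lévy weight exactly
as the crux's `let`s. Nothing here is proved; every `def … : Prop` elaborates over tree declarations.
-/

noncomputable section

open MeasureTheory Filter Set
open scoped ENNReal NNReal BigOperators ComplexConjugate

namespace Summit.AtomisticToContinuum.BoseEinsteinCondensation.Cruxes.InfraredMinimumUncertainty.Sketch3

open Literature.MathematicalPhysics.QuantumManyBody.BoseGas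
open Summit.AtomisticToContinuum.BoseEinsteinCondensation.Theses.BECConjugateDomination
  (InfraredMinimumUncertainty)
open Summit.AtomisticToContinuum.BoseEinsteinCondensation.Theses.BECSectorPoincareTwoScale
  (LandauSectorBound EnergyConvexityWindow)
open Summit.AtomisticToContinuum.BoseEinsteinCondensation.Theses.BECInsertionCorrector
  (StaticResponseBound)

/-! ## Objects -/

/-- Wave vector `k = 2π m / L`. -/
def waveVec (L : ℝ) (m : Fin 3 → ℤ) : Space :=
  (2 * Real.pi / L) • latticeVec 1 m

/-- `‖v‖₁ = ∫_{ℝ³} v(|x|) dx = v̂(0)` (first Born constant `8πa_B ≥ 8πa`). -/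
def potL1 (v : ℝ → ℝ≥0∞) : ℝ :=
  ∫ x : Space, (v ‖x‖).toReal

/-- `n_m / N = ∫_{cell^n} |∫_cell L^{-3/2} conj(e_m(x)) Ψ(x, Y) dx|² dY` — occupation fraction of the
normalised plane wave `m` (so `n_m = (n+1) · occFrac`; `∑_m n_m = N`; `n_m / N = ĉ_m(g)`). -/
def occFrac (n : ℕ) (L : ℝ) (ψ : Config (n + 1) → ℂ) (m : Fin 3 → ℤ) : ℝ :=
  ∫ Y in cellN n L, ‖∫ x in cell L, starRingEnd ℂ (cellWave L m x) * ψ (Matrix.vecCons x Y)‖ ^ 2 / L ^ 3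

/-- The crux's structure factor `S_m = N⁻¹ ∫ |∑ⱼ e_m(xⱼ)|² |Ψ|²`. -/
def structureFactor (n : ℕ) (L : ℝ) (Ψ : PeriodicTrialState (n + 1) L) (m : Fin 3 → ℤ) : ℝ :=
  ((n : ℝ) + 1)⁻¹ * ∫ X in cellN (n + 1) L, ‖∑ j : Fin (n + 1), cellWave L m (X j)‖ ^ 2 * ‖Ψ.ψ X‖ ^ 2

/-- The crux's coherence `g(r)`. -/
def coherence (n : ℕ) (L : ℝ) (Ψ : PeriodicTrialState (n + 1) L) (r : Space) : ℝ :=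
  ∫ x in cell L, ∫ Y in cellN n L, ‖Ψ.ψ (Matrix.vecCons (x + r) Y)‖ * ‖Ψ.ψ (Matrix.vecCons x Y)‖

/-- The crux's Lévy weight `ν_m = Re ĉ_m(log g)`. -/
def levyWeight (n : ℕ) (L : ℝ) (Ψ : PeriodicTrialState (n + 1) L) (m : Fin 3 → ℤ) : ℝ :=
  (cellFourierCoeff L (fun r : Space => ((Real.log (coherence n L Ψ r) : ℝ) : ℂ)) m).re

/-- Overlap `⟨Φ, a†(e_m) Ω⟩` of an `(n+2)`-particle trial state `Φ` with the ONE-PARTICLE ADDITION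
vector `u₊ = a†(e_m)Ω = (n+2)^{-1/2} ∑ᵢ e_m(xᵢ) Ω(X_{≠i})` (by Bose symmetry of `Φ` the `n+2` terms
coincide): `√(n+2) ∫ conj Φ(X') e_m(X'₀) Ω(tail X') dX'`; `‖u₊‖² = n_m + 1`. -/
def addOverlap (n : ℕ) (L : ℝ) (Ω : Config (n + 1) → ℂ) (m : Fin 3 → ℤ)
    (Φ : Config (n + 2) → ℂ) : ℂ :=
  (Real.sqrt (n + 2) : ℂ) * ∫ X' in cellN (n + 2) L,
    starRingEnd ℂ (Φ X') * (cellWave L m (X' 0) / (Real.sqrt (L ^ 3) : ℂ)) * Ω (Fin.tail X')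

/-- Overlap `⟨Φ, a(e_m) Ω⟩` of an `n`-particle trial state `Φ` with the ONE-PARTICLE REMOVAL vector
`u₋(Y) = a(e_m)Ω = √(n+1) ∫ conj e_m(x) Ω(x, Y) dx`; `‖u₋‖² = n_m`. -/
def remOverlap (n : ℕ) (L : ℝ) (Ω : Config (n + 1) → ℂ) (m : Fin 3 → ℤ)
    (Φ : Config n → ℂ) : ℂ :=
  (Real.sqrt (n + 1) : ℂ) * ∫ Y in cellN n L, starRingEnd ℂ (Φ Y) *
    ∫ x in cell L, starRingEnd ℂ (cellWave L m x / (Real.sqrt (L ^ 3) : ℂ)) * Ω (Matrix.vecCons x Y)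

/-! ## Card `landau-floor-two-channel` — first lemmas -/

/-- **FeynmanCeilingOfFloor** (density channel; provable now). If the torus minimiser `Ψ` is real and
translation invariant and the total-momentum sector `k = 2πm/L` lies `F` above `E₀`, then
`F · S_m ≤ ‖k‖²`. Proof: `ρ_k Ψ = (∑ⱼ e_m(xⱼ))Ψ` is a Bloch-`k` trial state and the weak
Euler–Lagrange equation of the real minimiser gives the f-sum identity
`E[ρ_kΨ/‖ρ_kΨ‖] = E₀ + N‖k‖²/‖ρ_kΨ‖² = E₀ + ‖k‖²/S_m` (Feynman–Bijl); compare with the floor. -/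
def FeynmanCeilingOfFloor : Prop :=
  ∀ v : ℝ → ℝ≥0∞, ∀ n : ℕ, ∀ L : ℝ, 0 < L → ∀ m : Fin 3 → ℤ, m ≠ 0 → ∀ F : ℝ, 0 ≤ F →
    ∀ Ψ : PeriodicTrialState (n + 1) L,
      periodicEnergy v Ψ = periodicGroundStateEnergy v (n + 1) L → periodicEnergy v Ψ ≠ ⊤ →
      (∀ X, Ψ.ψ X = (‖Ψ.ψ X‖ : ℂ)) → HasTotalMomentum 0 Ψ.ψ →
      periodicGroundStateEnergy v (n + 1) L + ENNReal.ofReal F ≤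
        momentumSectorEnergy v (n + 1) L (waveVec L m) →
      F * structureFactor n L Ψ m ≤ ‖waveVec L m‖ ^ 2

/-- **TwoSectorSandwich** (particle channel; provable now, size L). For the real, translation-invariant
minimiser `Ω` of `H_N` (`N = n+1`) and `m ≠ 0`: if the sector `k` of `H_{N+1}` lies `F` above
`E₀(N+1)` and the sector `−k` of `H_{N−1}` lies `F` above `E₀(N−1)`, then
`(2 n_m + 1) · F ≤ ‖k‖² + 2 (N/L³) ‖v‖₁ + η · n_m`,  `η := (2E₀(N) − E₀(N+1) − E₀(N−1))₊`.
Mechanism (Kennedy–Lieb–Shastry two-sector bookkeeping with FIRST moments only): the addition vector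
`u₊ = a†(e_m)Ω` (Bloch `k`, `‖u₊‖² = n_m+1`) and the removal vector `u₋ = a(e_m)Ω` (Bloch `−k`,
`‖u₋‖² = n_m`) have
`⟨u₊,(H−E₀(N+1))u₊⟩ + ⟨u₋,(H−E₀(N−1))u₋⟩ = ⟨[a,[H,a†]]⟩_Ω + E₀(N)(2n_m+1) − E₀(N+1)(n_m+1) − E₀(N−1)n_m`
with the double commutator `= ‖k‖² + (N/L³)v̂(0) + L⁻³∑_q v̂(q) n_{k+q} ≤ ‖k‖² + 2(N/L³)‖v‖₁`
(no `v(0)` and no `n_m` term: the `−N̂` of the pair interaction cancels the normal-ordering constant),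
and `E₀(N) ≤ E₀(N+1)` (`v ≥ 0`). Floors turn the left side into `≥ F(2n_m+1)`. -/
def TwoSectorSandwich : Prop :=
  ∀ v : ℝ → ℝ≥0∞, IsRepulsiveFiniteRange v → (∀ r, v r ≠ ⊤) →
    ∀ n : ℕ, ∀ L : ℝ, 0 < L → ∀ m : Fin 3 → ℤ, m ≠ 0 → ∀ F : ℝ, 0 ≤ F →
    ∀ Ω : PeriodicTrialState (n + 1) L,
      periodicEnergy v Ω = periodicGroundStateEnergy v (n + 1) L → periodicEnergy v Ω ≠ ⊤ →
      (∀ X, Ω.ψ X = (‖Ω.ψ X‖ : ℂ)) → HasTotalMomentum 0 Ω.ψ →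
      periodicGroundStateEnergy v (n + 2) L + ENNReal.ofReal F ≤
        momentumSectorEnergy v (n + 2) L (waveVec L m) →
      periodicGroundStateEnergy v n L + ENNReal.ofReal F ≤
        momentumSectorEnergy v n L (-(waveVec L m)) →
      let N : ℝ := (n : ℝ) + 1
      let nm : ℝ := N * occFrac n L Ω.ψ m
      let E0 : ℕ → ℝ := fun M => (periodicGroundStateEnergy v M L).toReal
      let η : ℝ := max 0 (2 * E0 (n + 1) - E0 (n + 2) - E0 n)
      (2 * nm + 1) * F ≤ ‖waveVec L m‖ ^ 2 + 2 * (N / L ^ 3) * potL1 v + η * nm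

/-! ## Card `susceptibility-product-two-channel` — first lemma -/

/-- **SusceptibilityProduct** (provable now, size M given `TwoSectorSandwich`'s energy identity).
Susceptibility (chord) form of the same bookkeeping: if the one-particle ADDITION and REMOVAL
susceptibilities are bounded in chord form — for all `s ≥ 0` and all trial states `Φ`,
`E₀(N±1) + 2s·Re⟨Φ, u_±⟩ − B_± s² ≤ E[Φ]` (i.e. `b_± = ⟨u_±,(H−E₀(N±1))⁻¹u_±⟩ ≤ B_±`, the
particle-channel Gaussian-domination objects of `GaussianDominationCan`, stmt-9479) — then the KLS
spectral Cauchy–Schwarz `m₀ ≤ √(m₁ m₋₁)` in each sector gives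
`(2 n_m + 1)² ≤ (B₊ + B₋) · (‖k‖² + 2(N/L³)‖v‖₁ + η n_m)`. -/
def SusceptibilityProduct : Prop :=
  ∀ v : ℝ → ℝ≥0∞, IsRepulsiveFiniteRange v → (∀ r, v r ≠ ⊤) →
    ∀ n : ℕ, ∀ L : ℝ, 0 < L → ∀ m : Fin 3 → ℤ, m ≠ 0 → ∀ Bp Bm : ℝ, 0 ≤ Bp → 0 ≤ Bm →
    ∀ Ω : PeriodicTrialState (n + 1) L,
      periodicEnergy v Ω = periodicGroundStateEnergy v (n + 1) L → periodicEnergy v Ω ≠ ⊤ →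
      (∀ X, Ω.ψ X = (‖Ω.ψ X‖ : ℂ)) → HasTotalMomentum 0 Ω.ψ →
      (∀ s : ℝ, 0 ≤ s → ∀ Φ : PeriodicTrialState (n + 2) L,
        periodicGroundStateEnergy v (n + 2) L +
            ENNReal.ofReal (2 * s * (addOverlap n L Ω.ψ m Φ.ψ).re - Bp * s ^ 2) ≤
          periodicEnergy v Φ) →
      (∀ s : ℝ, 0 ≤ s → ∀ Φ : PeriodicTrialState n L,
        periodicGroundStateEnergy v n L +
            ENNReal.ofReal (2 * s * (remOverlap n L Ω.ψ m Φ.ψ).re - Bm * s ^ 2) ≤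
          periodicEnergy v Φ) →
      let N : ℝ := (n : ℝ) + 1
      let nm : ℝ := N * occFrac n L Ω.ψ m
      let E0 : ℕ → ℝ := fun M => (periodicGroundStateEnergy v M L).toReal
      let η : ℝ := max 0 (2 * E0 (n + 1) - E0 (n + 2) - E0 n)
      (2 * nm + 1) ^ 2 ≤ (Bp + Bm) * (‖waveVec L m‖ ^ 2 + 2 * (N / L ^ 3) * potL1 v + η * nm)

/-! ## Architecture (shared by both cards): the crux from an IR occupation law, a density ceiling,
the Lévy transfer and the UV tail -/

/-- The smooth-class frame of the crux (verbatim hypotheses), with the potential `v` passed to `P`. -/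
def Frame (P : (ℝ → ℝ≥0∞) → ℝ → ∀ (ρ : ℝ) (n : ℕ),
    PeriodicTrialState (n + 1) (sideLength ρ (n + 1)) → Prop) : Prop :=
  ∀ v : ℝ → ℝ≥0∞, IsRepulsiveFiniteRange v → (∀ r, v r ≠ ⊤) →
    ContDiff ℝ 2 (fun x : Space => (v ‖x‖).toReal) →
    (∃ Cₑ : ℝ, ∀ x : Space,
      ‖iteratedFDeriv ℝ 2 (fun x : Space => (v ‖x‖).toReal) x‖ ≤ Cₑ * Real.sqrt ((v ‖x‖).toReal)) →
    ∃ C : ℝ, 0 ≤ C ∧ ∃ ρ₀ : ℝ, 0 < ρ₀ ∧ ∀ ρ : ℝ, 0 < ρ → ρ < ρ₀ → ∀ᶠ n : ℕ in atTop,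
      ∀ Ψ : PeriodicTrialState (n + 1) (sideLength ρ (n + 1)),
        periodicEnergy v Ψ = periodicGroundStateEnergy v (n + 1) (sideLength ρ (n + 1)) →
        periodicEnergy v Ψ ≠ ⊤ → (∀ X, Ψ.ψ X = (‖Ψ.ψ X‖ : ℂ)) → (∀ X, Ψ.ψ X ≠ 0) → P v C ρ n Ψ

/-- **IR occupation law** (output of floor + sandwich, or of the susceptibility product): on the
phonon window `‖k‖ ≤ M₀√(ρa)`, `n_m · √(ρ a)‖k‖ ≤ C (‖k‖² + ρ‖v‖₁)` — the `1/|k|` law from above with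
the phonon slope. (`M₀` fixed by the cards at the matching scale of the UV tail.) -/
def IROccupationLaw (M₀ : ℝ) : Prop :=
  Frame fun v C ρ n Ψ => ∀ m : Fin 3 → ℤ, m ≠ 0 →
    let L := sideLength ρ (n + 1); let a := (scatteringLength v).toReal
    ‖waveVec L m‖ ≤ M₀ * Real.sqrt (ρ * a) →
      ((n : ℝ) + 1) * occFrac n L Ψ.ψ m * (Real.sqrt (ρ * a) * ‖waveVec L m‖) ≤
        C * (‖waveVec L m‖ ^ 2 + ρ * potL1 v)

/-- **IR density ceiling** (Feynman ceiling of the Landau floor, or `StaticResponseBound` stmt-12057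
with `m₀² ≤ m₁m₋₁`): on the window, `S_m · √(ρa) ≤ C‖k‖`. -/
def IRDensityCeiling (M₀ : ℝ) : Prop :=
  Frame fun v C ρ n Ψ => ∀ m : Fin 3 → ℤ, m ≠ 0 →
    let L := sideLength ρ (n + 1); let a := (scatteringLength v).toReal
    ‖waveVec L m‖ ≤ M₀ * Real.sqrt (ρ * a) →
      structureFactor n L Ψ m * Real.sqrt (ρ * a) ≤ C * ‖waveVec L m‖

/-- **Lévy transfer on the window** (log-series majorant `ν_m ≤ (n_m/N)/f + O(∑n²/N²)` plus
`f ≥ 1/2` by mode counting from the IR law and kinetic Chebyshev; the content of the earlier crux card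
`occupation-to-levy-continuity-transfer`, here as a glue target): `N ν_m √(ρa)‖k‖ ≤ C(‖k‖² + ρ‖v‖₁)`. -/
def IRLevyLaw (M₀ : ℝ) : Prop :=
  Frame fun v C ρ n Ψ => ∀ m : Fin 3 → ℤ, m ≠ 0 →
    let L := sideLength ρ (n + 1); let a := (scatteringLength v).toReal
    ‖waveVec L m‖ ≤ M₀ * Real.sqrt (ρ * a) →
      ((n : ℝ) + 1) * levyWeight n L Ψ m * (Real.sqrt (ρ * a) * ‖waveVec L m‖) ≤
        C * (‖waveVec L m‖ ^ 2 + ρ * potL1 v)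

/-- **UV Lévy tail** (the route's foreseen child `UltravioletLevyTail`, beyond the window):
`N ν_m S_m ≤ C` for `‖k‖ > M₀√(ρa)`. -/
def UVLevyTail (M₀ : ℝ) : Prop :=
  Frame fun v C ρ n Ψ => ∀ m : Fin 3 → ℤ, m ≠ 0 →
    let L := sideLength ρ (n + 1); let a := (scatteringLength v).toReal
    M₀ * Real.sqrt (ρ * a) < ‖waveVec L m‖ →
      ((n : ℝ) + 1) * levyWeight n L Ψ m * structureFactor n L Ψ m ≤ C

/-- Glue of the line (pure algebra on the window: `NνS·(ρa)‖k‖ ≤ C(‖k‖²+ρ‖v‖₁)·C'‖k‖·‖k‖⁻¹…`;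
precisely `N ν_m S_m ≤ C C' (‖k‖² + ρ‖v‖₁)/(ρ a) ≤ C C'(M₀² + ‖v‖₁/a)` on the window, and the tail
off it; `‖v‖₁/a ≥ 8π` is a constant of `v`). -/
def ImuGlue (M₀ : ℝ) : Prop :=
  IRLevyLaw M₀ → IRDensityCeiling M₀ → UVLevyTail M₀ → InfraredMinimumUncertainty

/-- Glue feeding the IR laws from the SHARED items of route `BECSectorPoincareTwoScale`
(card `landau-floor-two-channel`): Landau floors at `N` and `N ± 1` in the density window + energy
convexity + the two first lemmas. -/
def LandauGlue (M₀ : ℝ) : Prop :=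
  LandauSectorBound → EnergyConvexityWindow → FeynmanCeilingOfFloor → TwoSectorSandwich →
    IROccupationLaw M₀ ∧ IRDensityCeiling M₀

/-- Glue feeding the IR laws from the two susceptibility cruxes (card
`susceptibility-product-two-channel`): `StaticResponseBound` (stmt-12057) for the density channel, a
particle-channel chord bound (the content of `GaussianDominationCan`, stmt-9479, in the plain
two-sector form used by `SusceptibilityProduct`) and energy convexity. -/
def SusceptibilityGlue (M₀ : ℝ) (ParticleChannelGD : Prop) : Prop :=
  StaticResponseBound → ParticleChannelGD → EnergyConvexityWindow → SusceptibilityProduct →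
    IROccupationLaw M₀ ∧ IRDensityCeiling M₀

/-! ## UV tail: the particle-channel gap identity (both cards) -/

/-- The one-particle vertex `(V₁Ψ)(x, Y) = ∑ⱼ v^per(x − yⱼ) Ψ(x, Y)` (interaction felt by the tagged
particle), as a real-weighted amplitude. -/
def vertexAmp (n : ℕ) (L : ℝ) (v : ℝ → ℝ≥0∞) (ψ : Config (n + 1) → ℂ) (x : Space) (Y : Config n) : ℂ :=
  ((∑ j : Fin n, (periodizedPotential v L (x - Y j)).toReal : ℝ) : ℂ) * ψ (Matrix.vecCons x Y)

/-- `N · ‖P_k^{(1)} V₁ Ψ‖² = N ∫_{cell^n} |∫_cell L^{-3/2} conj(e_m(x)) (V₁Ψ)(x,Y) dx|² dY` — the vertex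
intensity at tagged-particle momentum `k` (physics: `≈ (8πa)² ρ² (S^β_k + σ²)`, `O((ρa)²)` when no
weighted Bragg peak). -/
def vertexIntensity (n : ℕ) (L : ℝ) (v : ℝ → ℝ≥0∞) (ψ : Config (n + 1) → ℂ) (m : Fin 3 → ℤ) : ℝ :=
  ((n : ℝ) + 1) * ∫ Y in cellN n L,
    ‖∫ x in cell L, starRingEnd ℂ (cellWave L m x) * vertexAmp n L v ψ x Y‖ ^ 2 / L ^ 3

/-- **UVParticleGap** (provable now, size M/L): projecting the eigen-equation on tagged-particle
momentum `k` gives `(‖k‖² + H_{N−1} − E₀(N)) χ_k = −⟨e_k, V₁Ψ⟩` with `‖χ_k‖² = n_k/N`; since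
`H_{N−1} ≥ E₀(N−1)` and `E₀(N) − E₀(N−1) ≤ (N−1)‖v‖₁/L³ =: μ_B` (one undressed insertion), the operator
on the left is `≥ ‖k‖² − μ_B ≥ ‖k‖²/2` once `‖k‖² ≥ 2μ_B`: there IS a gap in the particle channel beyond
the (Born) healing scale — Hugenholtz–Pines forbids it only as `k → 0`. Hence
`n_k ≤ 4 · vertexIntensity / ‖k‖⁴` for `‖k‖² ≥ 2 (N−1)‖v‖₁/L³` (Tan-tail shape `(ρa)²/k⁴`, mode-wise,
GIVEN a mode-wise bound on the vertex intensity = a WEIGHTED structure-factor ceiling). -/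
def UVParticleGap : Prop :=
  ∀ v : ℝ → ℝ≥0∞, IsRepulsiveFiniteRange v → (∀ r, v r ≠ ⊤) →
    ∀ n : ℕ, ∀ L : ℝ, 0 < L → ∀ m : Fin 3 → ℤ, m ≠ 0 →
    ∀ Ψ : PeriodicTrialState (n + 1) L,
      periodicEnergy v Ψ = periodicGroundStateEnergy v (n + 1) L → periodicEnergy v Ψ ≠ ⊤ →
      (∀ X, Ψ.ψ X = (‖Ψ.ψ X‖ : ℂ)) →
      2 * ((n : ℝ) / L ^ 3 * potL1 v) ≤ ‖waveVec L m‖ ^ 2 →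
      ((n : ℝ) + 1) * occFrac n L Ψ.ψ m ≤ 4 * vertexIntensity n L v Ψ.ψ m / ‖waveVec L m‖ ^ 4

end Summit.AtomisticToContinuum.BoseEinsteinCondensation.Cruxes.InfraredMinimumUncertainty.Sketch3
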